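/-
Copyright (c) 2026 the pub-hodgecm2 formalisation cell (harness21).  New file.
Origin: seat `prover-pub-hodgecm2-item6-p2-g8-0` (unit pub-hodgecm2-item6-p2, TRANSPOSITION item (vi) extra prover p2, gen 8; general
eta-inverses `CMField.ofPkg`/`HermSpace3.ofPkg`/`Level.ofPkg` added by gen 10 on pin-3's ask HOME/INBOX l.6751; gen 11: two stale
`open` lines dropped and `perL_ofPkg` re-typed for the general `Level.ofPkg`), 2026-08-21/22 — the PORT JOIN (J0′) under coordinator ruling HODGE FULL PORT 19:13:07Z (port_pkg 1.0, namespace KEPT `HodgeCM.*`, root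
`Summits/HodgeConjecture/HodgeCM/`) and the stage-2 lead's PRE-ACK of `CorCM/PortJoin/*` (HOME/INBOX l.5270 (b)).  KERNEL only: repackaging
maps and transports, every identification `rfl`; no hypothesis binder of the Hodge kind (T5: n/a-class); count-neutral; HC_CM is NOT proved.
-/
import Summits.HodgeConjecture.HodgeCM.Geometry.Statements
import Summits.HodgeConjecture.CorCM.Geometry.Statements
import HarnessLib

set_option autoImplicit false

noncomputable section

/-!
# PORT JOIN, part 1: a ported-package universe `HodgeCM.Universe` read as a tree universe `CorCM.Universe`

`port_pkg.py` lands the package HodgeCMPerL with its namespaces KEPT, so the tree carries TWO verbatim copies of the code structures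
`CMField`, `Face`, `HermSpace3`, `Level`, `Universe` (FILING.md R2/R3 twins: `Summit.HodgeConjecture.CorCM.*` ported 2026-08-20, and
`HodgeCM.*` ported by the script) — distinct Lean types with the same fields.  This file is the dictionary between the two copies:
field-by-field repackaging maps `CMField.toPkg`/`ofPkg`, `Face.toPkg`/`ofPkg`, `HermSpace3.toPkg`/`ofPkg`, `Level.toPkg`/`ofPkg` (mutually
inverse by structure eta, `rfl`), the universe functor
`Universe.ofPkg : HodgeCM.Universe → CorCM.Universe` (same nineteen carrier fields; the three code-indexed fields precomposed with the
maps), and the TRANSPORT of the face-form period statement `PeriodThmF` and of `HC_CM` along it — all by `rfl`.  Part 2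
(`PortJoin/PeriodThmF.lean`) identifies `Universe.ofPkg` of the ported MODEL universe with the tree's model universe (`rfl`) and plugs
the ported head `HodgeCM.Model.periodThmF_picardCM_of_GRU_thm418C` into the tree's E term.  HC_CM is NOT proved here.
-/

namespace Summit.HodgeConjecture.CorCM.PortJoin

/-- A tree CM-field code as a ported-package CM-field code (same carrier, same instances). [folklore] -/
def CMField.toPkg (F : Summit.HodgeConjecture.CorCM.CMField) : HodgeCM.CMField :=
  @HodgeCM.CMField.mk F.K F.instField F.instNumberField F.instIsCMField

/-- A tree face as a ported-package face of the repackaged field. [folklore] -/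
def Face.toPkg {F : Summit.HodgeConjecture.CorCM.CMField} (f : Summit.HodgeConjecture.CorCM.Face F) :
    HodgeCM.Face (CMField.toPkg F) :=
  ⟨f.Φ, f.p, f.p', f.place_ne⟩

/-- A tree hermitian 3-space as a ported-package one (`conjRingHomK` and the tree's `cmConjRingHom` agree by `rfl`). [folklore] -/
def HermSpace3.toPkg {F : Summit.HodgeConjecture.CorCM.CMField} {ι₁ : F →+* ℂ}
    (V : Summit.HodgeConjecture.CorCM.HermSpace3 F ι₁) : HodgeCM.HermSpace3 (CMField.toPkg F) ι₁ :=
  ⟨V.Hm, V.isHermitian, V.signature_ι₁, V.posDef_of_ne⟩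

/-- A tree level as a ported-package level of the repackaged hermitian space. [folklore] -/
def Level.toPkg {F : Summit.HodgeConjecture.CorCM.CMField} {ι₁ : F →+* ℂ}
    {V : Summit.HodgeConjecture.CorCM.HermSpace3 F ι₁} (Γ : Summit.HodgeConjecture.CorCM.Level V) :
    HodgeCM.Level (HermSpace3.toPkg V) :=
  ⟨Γ.Γ, Γ.K, Γ.isCompact_K, Γ.isOpen_K, Γ.arithmeticLevel_K, Γ.torsionFree⟩

/-- A ported-package CM-field code as a tree CM-field code (same carrier, same instances); inverse of `CMField.toPkg` by
structure eta (`toPkg_ofPkg`, `ofPkg_toPkg`, both `rfl`). [folklore] -/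
def CMField.ofPkg (L : HodgeCM.CMField) : Summit.HodgeConjecture.CorCM.CMField :=
  @Summit.HodgeConjecture.CorCM.CMField.mk L.K L.instField L.instNumberField L.instIsCMField

/-- `toPkg ∘ ofPkg = id` on CM-field codes (structure eta). [folklore] -/
@[simp] theorem CMField.toPkg_ofPkg (L : HodgeCM.CMField) : CMField.toPkg (CMField.ofPkg L) = L := rfl

/-- `ofPkg ∘ toPkg = id` on CM-field codes (structure eta). [folklore] -/
@[simp] theorem CMField.ofPkg_toPkg (F : Summit.HodgeConjecture.CorCM.CMField) : CMField.ofPkg (CMField.toPkg F) = F := rfl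

/-- A ported-package face as a tree face of the repackaged field. [folklore] -/
def Face.ofPkg {L : HodgeCM.CMField} (f : HodgeCM.Face L) : Summit.HodgeConjecture.CorCM.Face (CMField.ofPkg L) :=
  ⟨f.Φ, f.p, f.p', f.place_ne⟩

/-- `toPkg ∘ ofPkg = id` on faces (structure eta). [folklore] -/
@[simp] theorem Face.toPkg_ofPkg {L : HodgeCM.CMField} (f : HodgeCM.Face L) : Face.toPkg (Face.ofPkg f) = f := rfl

/-- `ofPkg ∘ toPkg = id` on faces (structure eta). [folklore] -/
@[simp] theorem Face.ofPkg_toPkg {F : Summit.HodgeConjecture.CorCM.CMField} (f : Summit.HodgeConjecture.CorCM.Face F) :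
    Face.ofPkg (Face.toPkg f) = f := rfl

/-- A ported-package hermitian 3-space over ANY ported field code as a tree one over the repackaged field (inverse of
`HermSpace3.toPkg` up to structure eta; at `L := CMField.toPkg F` its type is `CorCM.HermSpace3 F ι₁` definitionally). [folklore] -/
def HermSpace3.ofPkg {L : HodgeCM.CMField} {ι₁ : L →+* ℂ} (V : HodgeCM.HermSpace3 L ι₁) :
    Summit.HodgeConjecture.CorCM.HermSpace3 (CMField.ofPkg L) ι₁ :=
  ⟨V.Hm, V.isHermitian, V.signature_ι₁, V.posDef_of_ne⟩

/-- `toPkg ∘ ofPkg = id` on hermitian 3-spaces (structure eta). [folklore] -/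
@[simp] theorem HermSpace3.toPkg_ofPkg {L : HodgeCM.CMField} {ι₁ : L →+* ℂ} (V : HodgeCM.HermSpace3 L ι₁) :
    HermSpace3.toPkg (HermSpace3.ofPkg V) = V := rfl

/-- `ofPkg ∘ toPkg = id` on hermitian 3-spaces (structure eta). [folklore] -/
@[simp] theorem HermSpace3.ofPkg_toPkg {F : Summit.HodgeConjecture.CorCM.CMField} {ι₁ : F →+* ℂ}
    (V : Summit.HodgeConjecture.CorCM.HermSpace3 F ι₁) : HermSpace3.ofPkg (HermSpace3.toPkg V) = V := rfl

/-- A ported-package level of ANY ported hermitian space as a tree level of the repackaged space (inverse of `Level.toPkg` up to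
structure eta). [folklore] -/
def Level.ofPkg {L : HodgeCM.CMField} {ι₁ : L →+* ℂ} {V : HodgeCM.HermSpace3 L ι₁} (Γ : HodgeCM.Level V) :
    Summit.HodgeConjecture.CorCM.Level (HermSpace3.ofPkg V) :=
  ⟨Γ.Γ, Γ.K, Γ.isCompact_K, Γ.isOpen_K, Γ.arithmeticLevel_K, Γ.torsionFree⟩

/-- `toPkg ∘ ofPkg = id` on levels (structure eta). [folklore] -/
@[simp] theorem Level.toPkg_ofPkg {L : HodgeCM.CMField} {ι₁ : L →+* ℂ} {V : HodgeCM.HermSpace3 L ι₁} (Γ : HodgeCM.Level V) :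
    Level.toPkg (Level.ofPkg Γ) = Γ := rfl

/-- `ofPkg ∘ toPkg = id` on levels (structure eta). [folklore] -/
@[simp] theorem Level.ofPkg_toPkg {F : Summit.HodgeConjecture.CorCM.CMField} {ι₁ : F →+* ℂ}
    {V : Summit.HodgeConjecture.CorCM.HermSpace3 F ι₁} (Γ : Summit.HodgeConjecture.CorCM.Level V) :
    Level.ofPkg (Level.toPkg Γ) = Γ := rfl

/-- **A ported-package universe read as a tree universe**: the same carriers, cohomology, morphisms, products and CM data, the three
code-indexed fields `cmAV`, `cmAct`, `pms` precomposed with the repackaging maps. [folklore] -/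
def Universe.ofPkg (U : HodgeCM.Universe) : Summit.HodgeConjecture.CorCM.Universe where
  Var := U.Var
  dim := U.dim
  Coh := U.Coh
  instAddCommGroup := U.instAddCommGroup
  instModule := U.instModule
  instFinite := U.instFinite
  hodge := U.hodge
  alg := U.alg
  Mor := U.Mor
  idMor := U.idMor
  comp := U.comp
  pull := U.pull
  cup := U.cup
  tr := U.tr
  prod := U.prod
  fst := U.fst
  snd := U.snd
  IsAbelianVariety := U.IsAbelianVariety
  IsCMAbelianVariety := U.IsCMAbelianVariety
  cmAV K Φ := U.cmAV (CMField.toPkg K) Φ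
  cmAct K Φ := U.cmAct (CMField.toPkg K) Φ
  pms L ι₁ V Γ := U.pms (CMField.toPkg L) ι₁ (HermSpace3.toPkg V) (Level.toPkg Γ)

/-- **TRANSPORT of `PeriodThmF` along `Universe.ofPkg`** (any ported-package universe): repackage the quantified codes, keep every
carrier; all identifications are definitional. [folklore] -/
theorem periodThmF_ofPkg (U : HodgeCM.Universe) (hP : U.PeriodThmF) : (Universe.ofPkg U).PeriodThmF := by
  intro F hG h6 f ι₁ hadm V
  obtain ⟨Γ, Fm, α, hα, hne⟩ := hP (CMField.toPkg F) hG h6 (Face.toPkg f) ι₁ hadm (HermSpace3.toPkg V)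
  exact ⟨Level.ofPkg Γ, Fm, α, hα, hne⟩


/-- **TRANSPORT of the sextic statement `PerL`** (`W_per^L` verbatim, `Geometry/Statements.lean`) along `Universe.ofPkg`. [folklore] -/
theorem perL_ofPkg (U : HodgeCM.Universe) (hP : U.PerL) : (Universe.ofPkg U).PerL := by
  intro K L j hN hK hL φ hφ ι₁ hι t ht
  obtain ⟨V, Γ, Fm, α, hα, hne⟩ := hP (CMField.toPkg K) (CMField.toPkg L) j hN hK hL φ hφ ι₁ hι t ht
  exact ⟨HermSpace3.ofPkg V, Level.ofPkg Γ, Fm, α, hα, hne⟩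

/-- **TRANSPORT of `PerL44`** (PerL Thm 4.4 as proved: `∀ V, ∃ Γ …`) along `Universe.ofPkg`. [folklore] -/
theorem perL44_ofPkg (U : HodgeCM.Universe) (hP : U.PerL44) : (Universe.ofPkg U).PerL44 := by
  intro K L j hN hK hL φ hφ ι₁ hι t ht V
  obtain ⟨Γ, Fm, α, hα, hne⟩ := hP (CMField.toPkg K) (CMField.toPkg L) j hN hK hL φ hφ ι₁ hι t ht (HermSpace3.toPkg V)
  exact ⟨Level.ofPkg Γ, Fm, α, hα, hne⟩

/-- `HC_CM` of a universe is insensitive to the repackaging (it does not mention the code structures). [folklore] -/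
theorem hc_cm_ofPkg_iff (U : HodgeCM.Universe) : (Universe.ofPkg U).HC_CM ↔ U.HC_CM := Iff.rfl

end Summit.HodgeConjecture.CorCM.PortJoin

end
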